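import Summits.QuantumFields.YangMills.Theorems.UniversalDetectorBlindLatticeKernels
import Summits.QuantumFields.YangMills.Theorems.UniversalDetectorBlindQ2Template
import Summits.QuantumFields.YangMills.Theorems.UniversalDetectorTight6Sequential

/-!
# Route `UniversalDetector`, LINE «blind detector»: the stub `BlindSeqExtraction` of
# `Cruxes/NT/Lines/blind_detector.lean` HOLDS (stub 1 of item stmt-QuantumFields-24148 `BlindDetector`, shared with
# item stmt-QuantumFields-24177 `FixedTorusFirst.SomeTorusDetector`)

Fleet lead `ym-spine-19353-p1` g26 (crux `BalabanLadder.NT` = stmt-QuantumFields-19353, LINE g11-1 «blind detector» of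
ym-idea-8).  `blindSeqExtraction` has LITERALLY the type of the stub (the body of
`Summit.QuantumFields.YangMills.Cruxes.NT.BlindDetector.BlindSeqExtraction`), so the NT-side skeleton closes its
`stub_blindSeqExtraction` by `exact Summit.QuantumFields.YangMills.Cruxes.UniversalDetectorBlindExtraction.blindSeqExtraction`.

Content (blind SEQUENTIAL limit extraction on `Ω = {all zᵢ ≠ 0}`): along any `β_k → ∞`, `a(β_k) L_k → ∞` such that
the 36 rescaled plane kernels are eventually bounded off every `η`-ball (conclusion of the PROVED `HankelCeiling`)
and eventually axis-Lipschitz on box segments off the `η`-ball and outside the slab `|a z_k| < τ` (conclusion of the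
PROVED `HankelLongitudinal`), a subsequence of the full rescaled kernel `a⁻⁸ Cov_T(dens 0, dens z)` converges
uniformly on the lattice points of every orthant annulus to a kernel `K` that is measurable, continuous on `Ω`,
bounded off balls, even, `ϑ`-invariant, reflection positive on positive-time slabs, and reproduces the limits of the
Schwartz-weighted Riemann sums `Q2`.  Assembly of this seat's blind toolkit: `blindLatticeKernel_extraction`
(orthant modulus + gauge Arzelà–Ascoli), `latticeLimit_invariant_approx_blind` (evenness exact by
`cov_dens_zero_neg`; `ϑ` up to the time-axis defect `reflect_defect_of_axis`), `tendsto_latticeDoubleSum_blind`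
(hyperplane cutoffs) with the tree's `Q2_farBound_of_tight` and `Q2_nearKernel_blind`, and the tree's
`Q2_thetaTest_ge_neg_defect` with `rp_step_bound_of_axis` for slab reflection positivity.

HONEST FRAMING: an analysis support stub of an OPEN line; `BlindDetector` (24148) still needs `BlindDetectorRigidity`;
the cruxes `SchemeEdgeBit` (24146) / `SchemeCurvatureLaws` (24087), the residual `SkewAtEdgeScheme` (24149), the rung
`BalabanLadder.NT` and every summit statement remain open; the Yang–Mills mass gap is NOT proved by this. [folklore]
-/

set_option autoImplicit false

noncomputable section

namespace Summit.QuantumFields.YangMills.Cruxes.UniversalDetectorBlindExtraction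

open scoped SchwartzMap
open MeasureTheory Filter Topology Finset
open Literature.MathematicalPhysics.QuantumFieldTheory Literature.MathematicalPhysics.QuantumLattice
  Literature.Probability.LatticeModels
open Summit.QuantumFields.YangMills.Cruxes.OSLegsFromFemtoAndGap.DlrCollarTransfer
open Summit.QuantumFields.YangMills.Cruxes.UniversalDetectorPlaneTight (cov_dens_zero_eq_sum cov_dens_zero_neg
  tsupport_thetaTest_subset_slab Q2_farBound_of_tight Q2_thetaTest_ge_neg_defect ge_of_tendsto_of_neg_le)
open Summit.QuantumFields.YangMills.Cruxes.UniversalDetectorLimitExtraction (Q2_eq_normalised schwartz_latticeRiemannBound)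

/-- Negation preserves the centred box. [folklore] -/
theorem neg_mem_box_four {L : ℕ} {z : Site 4} (hz : z ∈ box 4 L) : -z ∈ box 4 L := by
  rw [mem_box] at hz ⊢
  intro i
  have := hz i
  simp only [Pi.neg_apply]
  omega

/-- The scaled embedding commutes with negation. [folklore] -/
theorem smul_siteToE_neg (s : ℝ) (z : Site 4) : s • siteToE (-z) = -(s • siteToE z) := by
  rw [← smul_neg]
  congr 1
  ext i
  simp [siteToE_apply]

/-- **The stub `BlindSeqExtraction` of LINE «blind detector» holds** (statement verbatim; see the module docstring).
[folklore] -/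
theorem blindSeqExtraction :
    open MeasureTheory Literature.MathematicalPhysics.QuantumFieldTheory Literature.MathematicalPhysics.QuantumLattice Literature.Probability.LatticeModels Summit.QuantumFields.YangMills.Cruxes.OSLegsFromFemtoAndGap.DlrCollarTransfer in ∀ (G : Type) [Group G] [TopologicalSpace G] [IsTopologicalGroup G] [CompactSpace G], IsCompactSimpleLieGroup G → letI : MeasurableSpace G := borel G; haveI : BorelSpace G := ⟨rfl⟩; ∀ (r : LatticeRep G) (a : ℝ → ℝ), (∀ β, 0 < a β) → Filter.Tendsto a Filter.atTop (nhds 0) → let ker : ℝ → ℕ → (Fin 4 → ℤ) → ℝ := (fun (β : ℝ) (L : ℕ) (z : Fin 4 → ℤ) => (a β)⁻¹ ^ 8 * (torusE G r β L (fun U => dens G r 0 U * dens G r z U) - torusE G r β L (dens G r 0) * torusE G r β L (dens G r z))); let ker6 : ℝ → ℕ → Fin 4 × Fin 4 → Fin 4 × Fin 4 → (Fin 4 → ℤ) → ℝ := (fun (β : ℝ) (L : ℕ) (p q : Fin 4 × Fin 4) (z : Fin 4 → ℤ) => (a β)⁻¹ ^ 8 * (torusE G r β L (fun U => plane G r p 0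 U * plane G r q z U) - torusE G r β L (plane G r p 0) * torusE G r β L (plane G r q z))); ∀ (βs : ℕ → ℝ) (Ls : ℕ → ℕ), Filter.Tendsto βs Filter.atTop Filter.atTop → Filter.Tendsto (fun k => a (βs k) * Ls k) Filter.atTop Filter.atTop → (∀ p q : Fin 4 × Fin 4, p.1 < p.2 → q.1 < q.2 → ∀ η : ℝ, 0 < η → ∃ C : ℝ, ∃ k₀ : ℕ, ∀ m : ℕ, k₀ ≤ m → ∀ z ∈ box 4 (Ls m), η ≤ ‖a (βs m) • siteToE z‖ → |ker6 (βs m) (Ls m) p q z| ≤ C) → (∀ p q : Fin 4 × Fin 4, p.1 < p.2 → q.1 < q.2 → ∀ η : ℝ, 0 < η → ∀ τ : ℝ, 0 < τ → ∃ Λ : ℝ, ∃ k₀ : ℕ, ∀ m : ℕ, k₀ ≤ m → ∀ (k : Fin 4) (z : Fin 4 → ℤ) (n : ℕ), (∀ j : ℕ, j ≤ n → z + Pi.single k (j : ℤ) ∈ box 4 (Ls m) ∧ η ≤ ‖a (βs m) • siteToE (z + Pi.single k (j : ℤ))‖ ∧ τ ≤ |a (βs m) * (z k + j)|) → |ker6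 (βs m) (Ls m) p q z - ker6 (βs m) (Ls m) p q (z + Pi.single k (n : ℤ))| ≤ Λ * (a (βs m) * n)) → ∃ (φ : ℕ → ℕ) (K : EuclideanSpace ℝ (Fin 4) → ℝ), StrictMono φ ∧ (∀ η ε : ℝ, 0 < η → 0 < ε → ∃ k₀ : ℕ, ∀ k : ℕ, k₀ ≤ k → ∀ z ∈ box 4 (Ls (φ k)), (∀ i : Fin 4, η ≤ |a (βs (φ k)) * (z i : ℝ)|) → ‖a (βs (φ k)) • siteToE z‖ ≤ η⁻¹ → |ker (βs (φ k)) (Ls (φ k)) z - K (a (βs (φ k)) • siteToE z)| ≤ ε) ∧ Measurable K ∧ ContinuousOn K {z | ∀ i : Fin 4, z i ≠ 0} ∧ (∀ η : ℝ, 0 < η → ∃ C : ℝ, ∀ z : EuclideanSpace ℝ (Fin 4), η ≤ ‖z‖ → |K z| ≤ C) ∧ (∀ z : EuclideanSpace ℝ (Fin 4), K (-z) = K z) ∧ (∀ z : EuclideanSpace ℝ (Fin 4), K (timeReflection 4 z) = K z) ∧ (∀ (w : SchwartzMap (EuclideanSpace ℝ (Fin 4)) ℝ) (t₀ T : ℝ),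 0 < t₀ → tsupport (w : EuclideanSpace ℝ (Fin 4) → ℝ) ⊆ {y | t₀ ≤ y 0 ∧ y 0 ≤ T} → 0 ≤ ∫ x, ∫ y, (thetaTest 4 w) x * w y * K (y - x)) ∧ (∀ (w₁ w₂ : SchwartzMap (EuclideanSpace ℝ (Fin 4)) ℝ) (t₀ T : ℝ), 0 < t₀ → tsupport (w₁ : EuclideanSpace ℝ (Fin 4) → ℝ) ⊆ {y | t₀ ≤ -(y 0) ∧ -(y 0) ≤ T} → tsupport (w₂ : EuclideanSpace ℝ (Fin 4) → ℝ) ⊆ {y | t₀ ≤ y 0 ∧ y 0 ≤ T} → Filter.Tendsto (fun k => Q2 G r (βs (φ k)) (Ls (φ k)) (a (βs (φ k))) w₁ w₂) Filter.atTop (nhds (∫ x, ∫ y, w₁ x * w₂ y * K (y - x)))) := by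
  intro G _ _ _ _ hG
  letI : MeasurableSpace G := borel G
  haveI : BorelSpace G := ⟨rfl⟩
  intro r a ha hlim
  dsimp only
  intro βs Ls hβ hL hBdd hLong
  -- the spacing sequence
  have hs : ∀ k, 0 < a (βs k) := fun k => ha _
  have hs0 : Tendsto (fun k => a (βs k)) atTop (𝓝 0) := hlim.comp hβ
  -- the full kernel is the sum of the 36 plane kernels
  have hsplit : ∀ (m : ℕ) (z : Site 4),
      (a (βs m))⁻¹ ^ 8 * (torusE G r (βs m) (Ls m) (fun U => dens G r 0 U * dens G r z U) -
          torusE G r (βs m) (Ls m) (dens G r 0) * torusE G r (βs m) (Ls m) (dens G r z)) =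
        ∑ t : {q : Fin 4 × Fin 4 // q.1 < q.2} × {q : Fin 4 × Fin 4 // q.1 < q.2},
          (a (βs m))⁻¹ ^ 8 * (torusE G r (βs m) (Ls m) (fun U => plane G r t.1.1 0 U * plane G r t.2.1 z U) -
            torusE G r (βs m) (Ls m) (plane G r t.1.1 0) * torusE G r (βs m) (Ls m) (plane G r t.2.1 z)) := by
    intro m z
    rw [cov_dens_zero_eq_sum r, Finset.mul_sum, Fintype.sum_prod_type]
    exact Finset.sum_congr rfl fun p _ => Finset.mul_sum _ _ _
  -- (S1) bound of the full kernel off every ball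
  have hB := seqBound_sum (fun k => a (βs k)) Ls
    (fun m (t : {q : Fin 4 × Fin 4 // q.1 < q.2} × {q : Fin 4 × Fin 4 // q.1 < q.2}) z =>
      (a (βs m))⁻¹ ^ 8 * (torusE G r (βs m) (Ls m) (fun U => plane G r t.1.1 0 U * plane G r t.2.1 z U) -
        torusE G r (βs m) (Ls m) (plane G r t.1.1 0) * torusE G r (βs m) (Ls m) (plane G r t.2.1 z)))
    (fun m z => (a (βs m))⁻¹ ^ 8 * (torusE G r (βs m) (Ls m) (fun U => dens G r 0 U * dens G r z U) -
        torusE G r (βs m) (Ls m) (dens G r 0) * torusE G r (βs m) (Ls m) (dens G r z))) hsplit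
    (fun t η hη => hBdd t.1.1 t.2.1 t.1.2 t.2.2 η hη)
  -- (S2) axis modulus of the full kernel (`τ = η`)
  have hAx : ∀ η : ℝ, 0 < η → ∃ (Λ : ℝ) (k₀ : ℕ), ∀ m, k₀ ≤ m → ∀ (kk : Fin 4) (z : Site 4) (n : ℕ),
      (∀ j : ℕ, j ≤ n → z + Pi.single kk (j : ℤ) ∈ box 4 (Ls m) ∧
        η ≤ ‖a (βs m) • siteToE (z + Pi.single kk (j : ℤ))‖ ∧ η ≤ |a (βs m) * ((z kk : ℝ) + j)|) →
      |(a (βs m))⁻¹ ^ 8 * (torusE G r (βs m) (Ls m) (fun U => dens G r 0 U * dens G r z U) -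
          torusE G r (βs m) (Ls m) (dens G r 0) * torusE G r (βs m) (Ls m) (dens G r z)) -
        (a (βs m))⁻¹ ^ 8 * (torusE G r (βs m) (Ls m) (fun U => dens G r 0 U * dens G r (z + Pi.single kk (n : ℤ)) U) -
          torusE G r (βs m) (Ls m) (dens G r 0) * torusE G r (βs m) (Ls m) (dens G r (z + Pi.single kk (n : ℤ))))| ≤
        Λ * (a (βs m) * n) := fun η hη =>
    seqAxis_sum (fun k => a (βs k)) Ls
      (fun m (t : {q : Fin 4 × Fin 4 // q.1 < q.2} × {q : Fin 4 × Fin 4 // q.1 < q.2}) z =>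
        (a (βs m))⁻¹ ^ 8 * (torusE G r (βs m) (Ls m) (fun U => plane G r t.1.1 0 U * plane G r t.2.1 z U) -
          torusE G r (βs m) (Ls m) (plane G r t.1.1 0) * torusE G r (βs m) (Ls m) (plane G r t.2.1 z)))
      (fun m z => (a (βs m))⁻¹ ^ 8 * (torusE G r (βs m) (Ls m) (fun U => dens G r 0 U * dens G r z U) -
          torusE G r (βs m) (Ls m) (dens G r 0) * torusE G r (βs m) (Ls m) (dens G r z))) hsplit η η
      (fun t => hLong t.1.1 t.2.1 t.1.2 t.2.2 η hη η hη)
  -- (S3) blind extraction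
  obtain ⟨φ, K, hφ, happ, hKm, hKc, hK0, hKb⟩ := blindLatticeKernel_extraction (fun k => a (βs k)) Ls
    (fun m z => (a (βs m))⁻¹ ^ 8 * (torusE G r (βs m) (Ls m) (fun U => dens G r 0 U * dens G r z U) -
      torusE G r (βs m) (Ls m) (dens G r 0) * torusE G r (βs m) (Ls m) (dens G r z))) hs hs0 hL hB hAx
  have hφk : ∀ k, k ≤ φ k := fun k => hφ.id_le k
  have hβ' : Tendsto (fun k => βs (φ k)) atTop atTop := hβ.comp hφ.tendsto_atTop
  have hL' : Tendsto (fun k => a (βs (φ k)) * (Ls (φ k) : ℝ)) atTop atTop := hL.comp hφ.tendsto_atTop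
  have hs' : ∀ k, 0 < a (βs (φ k)) := fun k => ha _
  have hs0' : Tendsto (fun k => a (βs (φ k))) atTop (𝓝 0) := hlim.comp hβ'
  have hs1' : ∀ᶠ k in atTop, a (βs (φ k)) ≤ 1 := hs0'.eventually (eventually_le_nhds one_pos)
  -- the symmetry transport
  have transport := latticeLimit_invariant_approx_blind (fun k => a (βs k)) Ls
    (fun m z => (a (βs m))⁻¹ ^ 8 * (torusE G r (βs m) (Ls m) (fun U => dens G r 0 U * dens G r z U) -
      torusE G r (βs m) (Ls m) (dens G r 0) * torusE G r (βs m) (Ls m) (dens G r z))) hs hs0 hL φ hφ K happ hKc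
  -- the `Q2` limits along the subsequence (used for the last two clauses)
  have hQ2 : ∀ (w₁ w₂ : 𝓢(EuclideanSpace ℝ (Fin 4), ℝ)) (t₀ T : ℝ), 0 < t₀ →
      tsupport (w₁ : EuclideanSpace ℝ (Fin 4) → ℝ) ⊆ {y | t₀ ≤ -(y 0) ∧ -(y 0) ≤ T} →
      tsupport (w₂ : EuclideanSpace ℝ (Fin 4) → ℝ) ⊆ {y | t₀ ≤ y 0 ∧ y 0 ≤ T} →
      Tendsto (fun k => Q2 G r (βs (φ k)) (Ls (φ k)) (a (βs (φ k))) w₁ w₂) atTop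
        (𝓝 (∫ x, ∫ y, w₁ x * w₂ y * K (y - x))) := by
    intro w₁ w₂ t₀ T ht₀ h₁ h₂
    obtain ⟨CK, hCK⟩ := hKb (2 * t₀) (by positivity)
    obtain ⟨C, k₀, hC⟩ := hB (2 * t₀) (by positivity)
    have hTb : ∀ᶠ k in atTop, ∀ z ∈ box 4 (Ls (φ k)), 2 * t₀ ≤ ‖a (βs (φ k)) • siteToE z‖ →
        |(a (βs (φ k)))⁻¹ ^ 8 * (torusE G r (βs (φ k)) (Ls (φ k)) (fun U => dens G r 0 U * dens G r z U) -
          torusE G r (βs (φ k)) (Ls (φ k)) (dens G r 0) * torusE G r (βs (φ k)) (Ls (φ k)) (dens G r z))| ≤ C :=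
      eventually_atTop.2 ⟨k₀, fun k hk z hz hzη => hC (φ k) (hk.trans (hφk k)) z hz hzη⟩
    have hM := Q2_farBound_of_tight r w₁ w₂ K ht₀ h₁ h₂ hCK (fun k => βs (φ k)) (fun k => Ls (φ k))
      (fun k => a (βs (φ k))) hs' hL' hTb
    have hnear := Q2_nearKernel_blind r w₁ w₂ K (fun k => βs (φ k)) (fun k => Ls (φ k))
      (fun k => a (βs (φ k))) hs' hL' happ
    have h := tendsto_latticeDoubleSum_blind w₁ w₂ K t₀ ht₀ (fun y hy => (h₁ hy).1) (fun y hy => (h₂ hy).1)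
      hKm hKc hKb (fun k => a (βs (φ k))) hs' hs0' (fun k => Ls (φ k)) hL'
      (fun k x x' => (a (βs (φ k)))⁻¹ ^ 8 * (torusE G r (βs (φ k)) (Ls (φ k)) (fun U => dens G r x U * dens G r x' U)
        - torusE G r (βs (φ k)) (Ls (φ k)) (dens G r x) * torusE G r (βs (φ k)) (Ls (φ k)) (dens G r x')))
      (C + CK) hM hnear
    refine h.congr fun k => ?_
    exact (Q2_eq_normalised G r (βs (φ k)) (Ls (φ k)) (hs' k).ne' w₁ w₂).symm
  refine ⟨φ, K, hφ, happ, hKm, hKc, hKb, ?_, ?_, ?_, ?_⟩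
  · -- evenness, from translation invariance on the torus
    intro z
    by_cases hz : ∀ i : Fin 4, z i ≠ 0
    · refine transport (fun _ z => -z) (fun v => -v) (Eventually.of_forall fun k z hz' =>
          ⟨neg_mem_box_four hz', smul_siteToE_neg _ _⟩) (fun η ε hη hε => Eventually.of_forall fun k z _ _ _ => ?_)
        z hz (fun i => by simpa using hz i) continuous_neg.continuousAt
      rw [cov_dens_zero_neg, sub_self, abs_zero]
      exact hε.le
    · have hz' : ¬ ∀ i : Fin 4, (-z) i ≠ 0 := by simpa using hz
      rw [hK0 z hz, hK0 (-z) hz']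
  · -- time-reflection invariance, from the vanishing time-axis defect
    intro z
    by_cases hz : ∀ i : Fin 4, z i ≠ 0
    · have hσz : ∀ i : Fin 4, timeReflection 4 z i ≠ 0 := by
        intro i
        rw [timeReflection_apply]
        split_ifs with hi
        · exact neg_ne_zero.2 (hz i)
        · exact hz i
      refine transport (fun _ z => siteReflect z) (timeReflection 4) (Eventually.of_forall fun k z hz' =>
          ⟨Summit.QuantumFields.YangMills.Cruxes.UniversalDetectorPlaneTight.siteReflect_mem_box hz',
            (Summit.QuantumFields.YangMills.Cruxes.UniversalDetectorPlaneTight.timeReflection_smul_siteToE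
              _ _).symm⟩) (fun η ε hη hε => ?_)
        z hz hσz (timeReflection 4).continuous.continuousAt
      -- the time-axis moduli at thresholds `η/2`
      have hη2 : 0 < η / 2 := half_pos hη
      choose Λ k₀ hΛ using fun t : {q : Fin 4 × Fin 4 // q.1 < q.2} × {q : Fin 4 × Fin 4 // q.1 < q.2} =>
        hLong t.1.1 t.2.1 t.1.2 t.2.2 (η / 2) hη2 (η / 2) hη2
      set Λt : ℝ := ∑ p : {q : Fin 4 × Fin 4 // q.1 < q.2}, ∑ q : {q : Fin 4 × Fin 4 // q.1 < q.2},
        max (Λ (p, q)) 0 with hΛt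
      have hdef : Tendsto (fun k => a (βs (φ k)) * Λt) atTop (𝓝 (0 * Λt)) := hs0'.mul_const Λt
      rw [zero_mul] at hdef
      have e1 : ∀ᶠ k in atTop, a (βs (φ k)) * Λt ≤ ε := hdef.eventually (eventually_le_nhds hε)
      have e2 : ∀ᶠ k in atTop, 2 * a (βs (φ k)) ≤ η := by
        have h2 : Tendsto (fun k => 2 * a (βs (φ k))) atTop (𝓝 (2 * 0)) := hs0'.const_mul 2
        rw [mul_zero] at h2
        exact h2.eventually (eventually_le_nhds hη)
      have e3 : ∀ᶠ k in atTop, η⁻¹ + 1 ≤ a (βs (φ k)) * Ls (φ k) := hL'.eventually_ge_atTop _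
      filter_upwards [e1, e2, e3, hs1', eventually_ge_atTop (univ.sup k₀)] with k hk1 hk2 hk3 hk4 hk5 z hzb hzη hzη'
      have hkk : ∀ t, k₀ t ≤ φ k := fun t => ((Finset.le_sup (mem_univ t)).trans hk5).trans (hφk k)
      -- no time wrap: `|z₀| + 1 ≤ L`
      have hz0 : |z 0| + 1 ≤ (Ls (φ k) : ℤ) := by
        have h1 : a (βs (φ k)) * |(z 0 : ℝ)| ≤ η⁻¹ := (smul_abs_zero_le_norm (hs' k).le z).trans hzη'
        have h2 : a (βs (φ k)) * (|(z 0 : ℝ)| + 1) ≤ a (βs (φ k)) * Ls (φ k) := by nlinarith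
        have h3 : |(z 0 : ℝ)| + 1 ≤ Ls (φ k) := le_of_mul_le_mul_left h2 (hs' k)
        have h4 : ((|z 0| + 1 : ℤ) : ℝ) ≤ (Ls (φ k) : ℝ) := by push_cast; exact h3
        exact_mod_cast h4
      have h := reflect_defect_of_axis r (βs (φ k)) (Ls (φ k)) (hs' k) hk2 (fun p q => max (Λ (p, q)) 0)
        (fun p q => le_max_right _ _) (fun p q kk w n hpath =>
          (hΛ (p, q) (φ k) (hkk (p, q)) kk w n hpath).trans
            (mul_le_mul_of_nonneg_right (le_max_left _ _) (by have := (hs' k).le; positivity))) hzb hz0 (hzη 0)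
      rw [abs_sub_comm] at h
      exact h.trans hk1
    · have hz' : ¬ ∀ i : Fin 4, timeReflection 4 z i ≠ 0 := by
        intro h
        apply hz
        intro i
        have hi := h i
        rw [timeReflection_apply] at hi
        split_ifs at hi with h0
        · exact neg_ne_zero.1 hi
        · exact hi
      rw [hK0 z hz, hK0 _ hz']
  · -- reflection positivity on time slabs
    intro w t₀ T ht₀ hw
    have hθ := tsupport_thetaTest_subset_slab w hw
    -- the defect `δ_k = 36 a Λ B²`
    have h2t : 0 < 2 * t₀ := by positivity
    choose Λ k₀ hΛ using fun t : {q : Fin 4 × Fin 4 // q.1 < q.2} × {q : Fin 4 × Fin 4 // q.1 < q.2} =>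
      hLong t.1.1 t.2.1 t.1.2 t.2.2 (2 * t₀) h2t (2 * t₀) h2t
    set Λt : ℝ := ∑ t : {q : Fin 4 × Fin 4 // q.1 < q.2} × {q : Fin 4 × Fin 4 // q.1 < q.2}, max (Λ t) 0 with hΛt
    have hΛt0 : 0 ≤ Λt := sum_nonneg fun t _ => le_max_right _ _
    have hΛle : ∀ t, max (Λ t) 0 ≤ Λt := fun t =>
      Finset.single_le_sum (f := fun t => max (Λ t) 0) (fun _ _ => le_max_right _ _) (mem_univ t)
    obtain ⟨B, hB0, hBw⟩ := schwartz_latticeRiemannBound (d := 4) w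
    have hδ : Tendsto (fun k => 36 * (a (βs (φ k)) * Λt) * B ^ 2) atTop (𝓝 0) := by
      have := ((hs0'.mul_const Λt).const_mul 36).mul_const (B ^ 2)
      simpa using this
    refine ge_of_tendsto_of_neg_le (hQ2 (thetaTest 4 w) w t₀ T ht₀ hθ hw) hδ ?_
    have e0 : ∀ᶠ k in atTop, 0 ≤ βs (φ k) := hβ'.eventually_ge_atTop 0
    have eL : ∀ᶠ k in atTop, 2 * |T| + 2 ≤ a (βs (φ k)) * Ls (φ k) := hL'.eventually_ge_atTop _
    filter_upwards [e0, hs1', eL, eventually_ge_atTop (univ.sup k₀)] with k h0 hk1 hkL hk5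
    have hkk : ∀ t, k₀ t ≤ φ k := fun t => ((Finset.le_sup (mem_univ t)).trans hk5).trans (hφk k)
    have hT1 := le_abs_self T
    have hL1 : 1 ≤ Ls (φ k) := by
      have h1 : (1 : ℝ) ≤ a (βs (φ k)) * Ls (φ k) := by linarith [abs_nonneg T]
      have h2 : a (βs (φ k)) * Ls (φ k) ≤ Ls (φ k) := by
        have := Nat.cast_nonneg (α := ℝ) (Ls (φ k)); nlinarith [hs' k]
      exact_mod_cast h1.trans h2
    have h2a : T + 2 * a (βs (φ k)) ≤ a (βs (φ k)) * Ls (φ k) := by linarith [abs_nonneg T]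
    have h2b : 2 * T + a (βs (φ k)) ≤ a (βs (φ k)) * Ls (φ k) := by linarith [abs_nonneg T]
    set E : ℝ := a (βs (φ k)) ^ 8 * (Λt * a (βs (φ k))) with hE
    have hE0 : 0 ≤ E := by have := (hs' k).le; positivity
    have hstep : ∀ x ∈ box 4 (Ls (φ k)), ∀ y ∈ box 4 (Ls (φ k)), t₀ ≤ a (βs (φ k)) * (x 0 : ℝ) →
        a (βs (φ k)) * (x 0 : ℝ) ≤ T → t₀ ≤ a (βs (φ k)) * (y 0 : ℝ) → a (βs (φ k)) * (y 0 : ℝ) ≤ T →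
        ∀ p q : {q : Fin 4 × Fin 4 // q.1 < q.2},
        |(torusE G r (βs (φ k)) (Ls (φ k)) (fun V => plane G r p.1 0 V * plane G r q.1 (siteReflect x - y) V) -
            torusE G r (βs (φ k)) (Ls (φ k)) (plane G r p.1 0) *
              torusE G r (βs (φ k)) (Ls (φ k)) (plane G r q.1 (siteReflect x - y))) -
          (torusE G r (βs (φ k)) (Ls (φ k)) (fun V => plane G r p.1 0 V *
              plane G r q.1 ((if q.1.1 = 0 then siteReflect x - Pi.single 0 1 else siteReflect x) - y) V) -
            torusE G r (βs (φ k)) (Ls (φ k)) (plane G r p.1 0) *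
              torusE G r (βs (φ k)) (Ls (φ k))
                (plane G r q.1 ((if q.1.1 = 0 then siteReflect x - Pi.single 0 1 else siteReflect x) - y)))| ≤ E := by
      intro x _ y _ hx1 hx2 hy1 hy2 p q
      exact rp_step_bound_of_axis r (βs (φ k)) (Ls (φ k)) (hs' k) ht₀ h2b p.1 q.1 hΛt0 (fun kk w n hpath =>
        (hΛ (p, q) (φ k) (hkk (p, q)) kk w n hpath).trans
          (mul_le_mul_of_nonneg_right ((le_max_left _ _).trans (hΛle (p, q)))
            (by have := (hs' k).le; positivity))) hx1 hx2 hy1 hy2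
    have hQ := Q2_thetaTest_ge_neg_defect r h0 hL1 (hs' k) ht₀ h2a w hw hE0 hstep
    -- `36 E (Σ|w(a x)|)² = 36 a Λ (a⁴ Σ|w(a x)|)² ≤ 36 a Λ B²`
    have hS := hBw (Ls (φ k)) (a (βs (φ k))) (hs' k) hk1
    have hS0 : 0 ≤ a (βs (φ k)) ^ 4 * ∑ x ∈ box 4 (Ls (φ k)), |w (a (βs (φ k)) • siteToE x)| := by
      have := (hs' k).le; positivity
    have hsq : (a (βs (φ k)) ^ 4 * ∑ x ∈ box 4 (Ls (φ k)), |w (a (βs (φ k)) • siteToE x)|) ^ 2 ≤ B ^ 2 :=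
      pow_le_pow_left₀ hS0 hS 2
    have hEeq : 36 * E * (∑ x ∈ box 4 (Ls (φ k)), |w (a (βs (φ k)) • siteToE x)|) ^ 2 =
        36 * (a (βs (φ k)) * Λt) * (a (βs (φ k)) ^ 4 * ∑ x ∈ box 4 (Ls (φ k)), |w (a (βs (φ k)) • siteToE x)|) ^ 2 := by
      rw [hE]; ring
    have hle : 36 * E * (∑ x ∈ box 4 (Ls (φ k)), |w (a (βs (φ k)) • siteToE x)|) ^ 2 ≤
        36 * (a (βs (φ k)) * Λt) * B ^ 2 := by
      rw [hEeq]
      exact mul_le_mul_of_nonneg_left hsq (by have := (hs' k).le; positivity)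
    linarith
  · -- the limits of the Schwartz-weighted Riemann sums
    intro w₁ w₂ t₀ T ht₀ h₁ h₂
    exact hQ2 w₁ w₂ t₀ T ht₀ h₁ h₂

end Summit.QuantumFields.YangMills.Cruxes.UniversalDetectorBlindExtraction

end
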